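import Literature.NumberTheory.LFunctions.ZetaScrew
import HarnessLib

/-!
# Two-point convexity of Suzuki's prime sum `φ` on `[0, ∞)` (stub `stub_primeSumConvexCombo` of
crux `SparseScrewLandau.QuarticSampleLandau`, stmt-RiemannHypothesis-23405)

Route `SparseScrewLandau` (L41 «sparse screw Landau»), line «quartic chord», registered stub 1 — the
PRIME-SIDE input of the line.  `φ(t) = zetaScrewPrimeSum t = ∑_{n ≤ e^{|t|}} Λ(n) n^{-1/2} (|t| - log n)`
(Suzuki 2023, arXiv:2206.03682, (1.1)/Prop. 2.1) is, on `[0, ∞)`, the non-negative combination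
`∑_n Λ(n) n^{-1/2} · max(t - log n, 0)` of hinge functions (`zetaScrewPrimeSum_eq_sum_max`), hence convex;
the only arithmetic input is `Λ(n) ≥ 0`.  We prove the two-point form
`φ(s u + (1-s) v) ≤ s φ(u) + (1-s) φ(v)` for `0 ≤ u ≤ v`, `s ∈ [0, 1]`.

RH is not proved by this file; nothing here bears on the truth of RH.
-/

-- `Summit.RiemannHypothesis.RiemannHypothesis.…` repeats a component by the tree's layout (D-0017).
set_option linter.dupNamespace false

noncomputable section

namespace Summit.RiemannHypothesis.RiemannHypothesis.Theorems.SparseScrewLandau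

open Literature.NumberTheory.LFunctions

/-- Two-point convexity of a hinge: `max(s a + (1-s) b, 0) ≤ s max(a,0) + (1-s) max(b,0)` for
`s ∈ [0,1]`. -/
theorem max_convexCombo_zero_le {a b s : ℝ} (hs0 : 0 ≤ s) (hs1 : s ≤ 1) :
    max (s * a + (1 - s) * b) 0 ≤ s * max a 0 + (1 - s) * max b 0 := by
  have h1s : 0 ≤ 1 - s := sub_nonneg.2 hs1
  refine max_le ?_ ?_
  · exact add_le_add (mul_le_mul_of_nonneg_left (le_max_left a 0) hs0)
      (mul_le_mul_of_nonneg_left (le_max_left b 0) h1s)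
  · exact add_nonneg (mul_nonneg hs0 (le_max_right a 0)) (mul_nonneg h1s (le_max_right b 0))

/-- **Stub `stub_primeSumConvexCombo` (crux `SparseScrewLandau.QuarticSampleLandau`).** The prime sum
`φ = zetaScrewPrimeSum` is convex on `[0, ∞)` in the two-point form: for `0 ≤ u ≤ v` and `s ∈ [0,1]`,
`φ(s u + (1-s) v) ≤ s φ(u) + (1-s) φ(v)`.  Proof: truncate all three sums at the common cut-off
`M = ⌈e^v⌉` (`zetaScrewPrimeSum_eq_sum_max`), compare termwise using `Λ(n) n^{-1/2} ≥ 0` and the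
convexity of the hinge `t ↦ max(t - log n, 0)`. -/
theorem stub_primeSumConvexCombo :
    ∀ u v s : ℝ, 0 ≤ u → u ≤ v → 0 ≤ s → s ≤ 1 →
      zetaScrewPrimeSum (s * u + (1 - s) * v) ≤
        s * zetaScrewPrimeSum u + (1 - s) * zetaScrewPrimeSum v := by
  intro u v s hu huv hs0 hs1
  have h1s : 0 ≤ 1 - s := sub_nonneg.2 hs1
  set w : ℝ := s * u + (1 - s) * v with hw
  have hv : 0 ≤ v := hu.trans huv
  have hwv : w ≤ v := by rw [hw]; nlinarith
  have huw : u ≤ w := by rw [hw]; nlinarith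
  have hw0 : 0 ≤ w := hu.trans huw
  -- common cut-off
  set M : ℕ := ⌈Real.exp v⌉₊ with hM
  have hMv : Real.exp |v| ≤ M := by rw [abs_of_nonneg hv]; exact Nat.le_ceil _
  have hMu : Real.exp |u| ≤ M := by
    rw [abs_of_nonneg hu]
    exact ((Real.exp_le_exp.2 huv).trans (Nat.le_ceil _))
  have hMw : Real.exp |w| ≤ M := by
    rw [abs_of_nonneg hw0]
    exact ((Real.exp_le_exp.2 hwv).trans (Nat.le_ceil _))
  rw [zetaScrewPrimeSum_eq_sum_max hMw, zetaScrewPrimeSum_eq_sum_max hMu,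
    zetaScrewPrimeSum_eq_sum_max hMv, abs_of_nonneg hw0, abs_of_nonneg hu, abs_of_nonneg hv,
    Finset.mul_sum, Finset.mul_sum, ← Finset.sum_add_distrib]
  refine Finset.sum_le_sum fun n _ ↦ ?_
  have hc : 0 ≤ (ArithmeticFunction.vonMangoldt n : ℝ) / Real.sqrt n :=
    div_nonneg ArithmeticFunction.vonMangoldt_nonneg (Real.sqrt_nonneg _)
  have hkey : max (w - Real.log n) 0 ≤
      s * max (u - Real.log n) 0 + (1 - s) * max (v - Real.log n) 0 := by
    have := max_convexCombo_zero_le (a := u - Real.log n) (b := v - Real.log n) hs0 hs1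
    have hrw : s * (u - Real.log n) + (1 - s) * (v - Real.log n) = w - Real.log n := by
      rw [hw]; ring
    rwa [hrw] at this
  calc ArithmeticFunction.vonMangoldt n / Real.sqrt n * max (w - Real.log n) 0
      ≤ ArithmeticFunction.vonMangoldt n / Real.sqrt n *
          (s * max (u - Real.log n) 0 + (1 - s) * max (v - Real.log n) 0) :=
        mul_le_mul_of_nonneg_left hkey hc
    _ = s * (ArithmeticFunction.vonMangoldt n / Real.sqrt n * max (u - Real.log n) 0) +
          (1 - s) * (ArithmeticFunction.vonMangoldt n / Real.sqrt n * max (v - Real.log n) 0) := by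
        ring

end Summit.RiemannHypothesis.RiemannHypothesis.Theorems.SparseScrewLandau

end
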